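import Summits.CriticalPhenomena.PercolationContinuityZ3.Theorems.PercNearOneGluingNoHeavyLowerTailSahiGridPatternTwoOrthantTop

/-!
# `NoHeavyLowerTail` (crux stmt-CriticalPhenomena-4575), Sahi programme P1: **LITERAL ABSORPTION — a threshold-one literal OR any
# block pattern is a good slot of the pattern functional in EVERY dimension**

Support file (Sahi cell, seat `prim-sahi-p1`, generation 21; `--supports stmt-CriticalPhenomena-4575`).  Pure proofs, no definitions,
no `sorry`, standard axioms.  Continues `…SahiGridPatternTwoOrthantTop`.

THE MATHEMATICS.  The two-orthant identity of the seat memo (FROM-prim-sahi-p1-gen21-TWO-ORTHANT-THEOREM.md) holds for the paying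
block `X_I = ↑a` and an ARBITRARY up-set `Y_J` in the other block; of its eight families only two need more than `Y_J` being an up-set:
the Conjecture-P family (pairs of totally distinct points outside `X_I`) and the `Q_E` family (completions of a point of `X_I` to a
Latin triple by two outside points).  For the one-axis block with threshold one, `X_I = {1,2} ⊆ [3]`, the outside is the single point `0`,
so BOTH families are empty (`ind_literal_pair_one`, `ind_literal_third_one`).  Hence (`literalUnion_hS`) hypothesis `hS` of
`sStarD_cylSet_pairCert_nonneg_of_sStarD_ge` holds for `X_I = {1,2}` and EVERY up-set `Y_J ⊆ [3]^k`, and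
(**`sStarD_cylSet_literalUnion_nonneg`**) for every `k`, every up-set `Y_J ⊆ [3]^k`, every `m` and all up-sets `B, C ⊆ [3]^{m+(1+k)}`:
`0 ≤ sStarD (({1,2} × [3]^k ∪ [3] × Y_J) × [3]^m) B C` — the pattern "`x₀ ≥ 1` OR (anything increasing in the other coordinates)" is a
good slot in every dimension, whether or not `Y_J` itself is.  (For the threshold-two literal `{2}` the Conjecture-P family is the pair
`(0,1),(1,0)` and the statement genuinely depends on `Y_J`: it fails for 9 of the 20 up-sets of `[3]^2`, seat notes.)
Nothing here asserts `PatternPos d` for `d ≥ 4`. [this work]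
-/

namespace Summit.CriticalPhenomena.PercolationContinuityZ3.Theorems.SahiGridPattern

open Finset SahiGrid3
open scoped BigOperators

variable {k : ℕ}

/-- Two distinct values of `[3]` are never both below `1`. [this work] -/
theorem fin3_ne_one_le_or : ∀ u v : Fin 3, u ≠ v → (1 ≤ u ∨ 1 ≤ v) := by decide

/-- For two distinct values `u ≠ v` of `[3]`, the second or the third value `−(u+v)` of their Latin triple is `≥ 1`. [this work] -/
theorem fin3_ne_one_le_or_third : ∀ u v : Fin 3, u ≠ v → (1 ≤ v ∨ 1 ≤ -(u + v)) := by decide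

/-- Membership in the threshold-one literal `↑a ⊆ [3]^1` (`a = 1`) from `1 ≤ x 0`. [this work] -/
theorem ind_literal_eq_one (a : Pd 1) (ha : ∀ i, a i = 1) {x : Pd 1} (hx : 1 ≤ x 0) :
    ind (univ.filter fun y : Pd 1 => ∀ i, a i ≤ y i) x = 1 := by
  unfold ind
  rw [if_pos]
  simp only [Finset.mem_filter, Finset.mem_univ, true_and]
  intro i
  rw [ha i, Subsingleton.elim i 0]
  exact hx

/-- Of two totally distinct points of `[3]^1`, one lies in the literal `{1,2}`. [this work] -/
theorem ind_literal_pair_one (a : Pd 1) (ha : ∀ i, a i = 1) {ξ η : Pd 1} (hτ : TotDist ξ η = true) :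
    ind (univ.filter fun y : Pd 1 => ∀ i, a i ≤ y i) ξ = 1 ∨ ind (univ.filter fun y : Pd 1 => ∀ i, a i ≤ y i) η = 1 := by
  rcases fin3_ne_one_le_or (ξ 0) (η 0) (totDist_iff.mp hτ 0) with h | h
  · exact Or.inl (ind_literal_eq_one a ha h)
  · exact Or.inr (ind_literal_eq_one a ha h)

/-- Of the second and third points of a Latin triple of `[3]^1`, one lies in the literal `{1,2}`. [this work] -/
theorem ind_literal_third_one (a : Pd 1) (ha : ∀ i, a i = 1) {ξ η : Pd 1} (hτ : TotDist ξ η = true) :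
    ind (univ.filter fun y : Pd 1 => ∀ i, a i ≤ y i) η = 1
      ∨ ind (univ.filter fun y : Pd 1 => ∀ i, a i ≤ y i) (thirdPt ξ η) = 1 := by
  rcases fin3_ne_one_le_or_third (ξ 0) (η 0) (totDist_iff.mp hτ 0) with h | h
  · exact Or.inl (ind_literal_eq_one a ha h)
  · refine Or.inr (ind_literal_eq_one a ha ?_)
    show 1 ≤ -(ξ 0 + η 0)
    exact h

/-! ### Hypothesis `hS` for the literal `{1,2}` and an arbitrary up-set block -/

set_option maxHeartbeats 8000000 in
/-- **`hS` FOR A THRESHOLD-ONE LITERAL AND ANY UP-SET BLOCK**: with `X = {1,2} × [3]^k` (glued first block `↑a`, `a = 1 ∈ [3]^1`) and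
`Y = [3] × Y_J` for an ARBITRARY up-set `Y_J ⊆ [3]^k`, the pair-certificate lower bound `hS` of `sStarD_cylSet_pairCert_nonneg_of_sStarD_ge`
holds for all up-sets `A, A'`.  Proof: the two-orthant identity (36-fold symmetrised two-block pair sums, as in `twoOrthant_hS_of_ones`)
with the Conjecture-P and `Q_E` families identically zero. [this work] -/
theorem literalUnion_hS {X Y : Finset (Pd (1 + k))} (a : Pd 1) (ha : ∀ i, a i = 1) (YJ : Finset (Pd k))
    (hYJ : IsUpperSet (YJ : Set (Pd k)))
    (hX : ∀ ξ q, glue ξ q ∈ X ↔ ξ ∈ (univ.filter fun x : Pd 1 => ∀ i, a i ≤ x i))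
    (hY : ∀ ξ q, glue ξ q ∈ Y ↔ q ∈ YJ) :
    ∀ A A' : Finset (Pd (1 + k)), IsUpperSet (A : Set (Pd (1 + k))) → IsUpperSet (A' : Set (Pd (1 + k))) →
      2 ^ k * (∑ q : Pd k, (1 - ind YJ q) *
          ∑ ξ : Pd 1, ind (fibre (A ∩ A') q) ξ * (2 ^ 1 * ind (univ.filter fun x : Pd 1 => ∀ i, a i ≤ x i) ξ
            - (nuCount (univ.filter fun x : Pd 1 => ∀ i, a i ≤ x i) ξ : ℤ)))
        + (∑ ξ : Pd 1, (1 - ind (univ.filter fun x : Pd 1 => ∀ i, a i ≤ x i) ξ)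
            * (2 ^ 1 - (nuCount (univ.filter fun x : Pd 1 => ∀ i, a i ≤ x i) ξ : ℤ))
            * ∑ q : Pd k, ind (sect (A ∩ A') ξ) q * (2 ^ k * ind YJ q
              - (nuCount YJ q : ℤ)))
        ≤ sStarD (X ∪ Y) A A' := by
  intro A A' hA hA'
  set XI : Finset (Pd 1) := univ.filter fun x : Pd 1 => ∀ i, a i ≤ x i with hXI
  have ha0 : ∃ i, a i ≠ 0 := ⟨0, by rw [ha 0]; decide⟩
  rw [← sub_nonneg, sStarD_union_sub_pairCertSlack_eq_pairSum hX hY A A']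
  -- the two local kernels
  set κL : Pd 1 → Pd 1 → Pd 1 → Pd k → Pd k → Pd k → ℤ := (fun (ξ η ζ : Pd 1) (q r w : Pd k) => (2 * (ind XI ξ + ind YJ q - ind XI ξ * ind YJ q) * ind A (glue ξ q) * ind A' (glue ξ q) - (ind XI ξ + ind YJ q - ind XI ξ * ind YJ q) * ind A (glue η r) * ind A' (glue η r) - ind A (glue ξ q) * (ind XI η + ind YJ r - ind XI η * ind YJ r) * ind A' (glue η r) - ind A' (glue ξ q) * (ind XI η + ind YJ r - ind XI η * ind YJ r) * ind A (glue η r) + ind A (glue ξ q) * ind A' (glue η r) * (ind XI ζ + ind YJ w - ind XI ζ * ind YJ w) - ind A (glue ξ q) * ind A' (glue ξ q) * ((1 - ind YJ q) * (ind XI ξ - ind XI η) + (1 - ind XI ξ) * (1 - ind XI η) * (ind YJ q - ind YJ r)))) with hκL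
  set κ1 : Pd 1 → Pd 1 → Pd 1 → Pd k → Pd k → Pd k → ℤ := (fun (ξ η ζ : Pd 1) (q r w : Pd k) => (ind XI ξ * (1 - ind XI η)) * (ind A (glue ξ q) * (ind A' (glue η q) * ind YJ q - ind A' (glue η r) * ind YJ r))) with hκ1
  set κ2 : Pd 1 → Pd 1 → Pd 1 → Pd k → Pd k → Pd k → ℤ := (fun (ξ η ζ : Pd 1) (q r w : Pd k) => (ind XI ξ * (1 - ind XI η)) * (ind A' (glue ξ q) * (ind A (glue η q) * ind YJ q - ind A (glue η r) * ind YJ r))) with hκ2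
  set κ3 : Pd 1 → Pd 1 → Pd 1 → Pd k → Pd k → Pd k → ℤ := (fun (ξ η ζ : Pd 1) (q r w : Pd k) => (ind XI ξ * (1 - ind XI η)) * ((1 - ind YJ q) * ind A (glue ξ r) * (ind A' (glue ξ r) - ind A' (glue ξ w)))) with hκ3
  set κ4 : Pd 1 → Pd 1 → Pd 1 → Pd k → Pd k → Pd k → ℤ := (fun (ξ η ζ : Pd 1) (q r w : Pd k) => (ind XI ξ * ind XI η) * (ind A (glue ξ q) * (ind A' (glue ξ q) - ind A' (glue ξ r)))) with hκ4
  set κ5 : Pd 1 → Pd 1 → Pd 1 → Pd k → Pd k → Pd k → ℤ := (fun (ξ η ζ : Pd 1) (q r w : Pd k) => ((1 - ind XI ξ) * (1 - ind XI η)) * (ind A (glue ξ q) * ind A' (glue η q) * ind YJ q - ind A (glue ξ q) * ind A' (glue η r) * (ind YJ q + ind YJ r - ind YJ w))) with hκ5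
  set κ6 : Pd 1 → Pd 1 → Pd 1 → Pd k → Pd k → Pd k → ℤ := (fun (ξ η ζ : Pd 1) (q r w : Pd k) => ind YJ q * ((1 - ind XI ξ * ind XI η) * (ind A' (glue ξ q) * (ind A (glue ξ q) - ind A (glue η q))))) with hκ6
  set κ7 : Pd 1 → Pd 1 → Pd 1 → Pd k → Pd k → Pd k → ℤ := (fun (ξ η ζ : Pd 1) (q r w : Pd k) => (1 - ind YJ w) * ((ind XI ξ * ((1 - ind XI η) * (1 - ind XI ζ))) * ((ind A (glue ξ q) - ind A (glue η q)) * (ind A' (glue ξ r) - ind A' (glue ζ r))))) with hκ7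
  set κ8 : Pd 1 → Pd 1 → Pd 1 → Pd k → Pd k → Pd k → ℤ := (fun (ξ η ζ : Pd 1) (q r w : Pd k) => (2 - ind YJ w) * ((ind XI ξ * ind XI η) * ((ind A (glue ξ q) - ind A (glue η q)) * ind A' (glue ξ r)))) with hκ8
  set κR : Pd 1 → Pd 1 → Pd 1 → Pd k → Pd k → Pd k → ℤ :=
    (fun (ξ η ζ : Pd 1) (q r w : Pd k) => κ1 ξ η ζ q r w + κ2 ξ η ζ q r w + κ3 ξ η ζ q r w + κ4 ξ η ζ q r w
      + κ5 ξ η ζ q r w + κ6 ξ η ζ q r w + κ7 ξ η ζ q r w + κ8 ξ η ζ q r w) with hκR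
  -- the goal is `0 ≤ PS κL`
  show 0 ≤ (∑ ξ : Pd 1, ∑ η : Pd 1, ∑ q : Pd k, ∑ r : Pd k, (if TotDist ξ η = true then (1:ℤ) else 0) * (if TotDist q r = true then (1:ℤ) else 0) * (κL ξ η (thirdPt ξ η) q r (thirdPt q r)))
  -- symmetrisation: 36·PS(κ) = PS(sym36 κ)
  have hL6 := ps_symJ6 κL
  have hL36 := ps_symI6 (fun (ξ η ζ : Pd 1) (q r w : Pd k) => κL ξ η ζ q r w + κL ξ η ζ r q w + κL ξ η ζ q w r + κL ξ η ζ r w q + κL ξ η ζ w q r + κL ξ η ζ w r q)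
  try dsimp only at hL36
  have hR6 := ps_symJ6 κR
  have hR36 := ps_symI6 (fun (ξ η ζ : Pd 1) (q r w : Pd k) => κR ξ η ζ q r w + κR ξ η ζ r q w + κR ξ η ζ q w r + κR ξ η ζ r w q + κR ξ η ζ w q r + κR ξ η ζ w r q)
  try dsimp only at hR36
  -- the pointwise identity of the symmetrised kernels
  have hpt : (∑ ξ : Pd 1, ∑ η : Pd 1, ∑ q : Pd k, ∑ r : Pd k, (if TotDist ξ η = true then (1:ℤ) else 0) * (if TotDist q r = true then (1:ℤ) else 0) * ((κL ξ η (thirdPt ξ η) q r (thirdPt q r)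
            + κL ξ η (thirdPt ξ η) r q (thirdPt q r)
            + κL ξ η (thirdPt ξ η) q (thirdPt q r) r
            + κL ξ η (thirdPt ξ η) r (thirdPt q r) q
            + κL ξ η (thirdPt ξ η) (thirdPt q r) q r
            + κL ξ η (thirdPt ξ η) (thirdPt q r) r q)
          + (κL η ξ (thirdPt ξ η) q r (thirdPt q r)
            + κL η ξ (thirdPt ξ η) r q (thirdPt q r)
            + κL η ξ (thirdPt ξ η) q (thirdPt q r) r
            + κL η ξ (thirdPt ξ η) r (thirdPt q r) q
            + κL η ξ (thirdPt ξ η) (thirdPt q r) q r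
            + κL η ξ (thirdPt ξ η) (thirdPt q r) r q)
          + (κL ξ (thirdPt ξ η) η q r (thirdPt q r)
            + κL ξ (thirdPt ξ η) η r q (thirdPt q r)
            + κL ξ (thirdPt ξ η) η q (thirdPt q r) r
            + κL ξ (thirdPt ξ η) η r (thirdPt q r) q
            + κL ξ (thirdPt ξ η) η (thirdPt q r) q r
            + κL ξ (thirdPt ξ η) η (thirdPt q r) r q)
          + (κL η (thirdPt ξ η) ξ q r (thirdPt q r)
            + κL η (thirdPt ξ η) ξ r q (thirdPt q r)
            + κL η (thirdPt ξ η) ξ q (thirdPt q r) r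
            + κL η (thirdPt ξ η) ξ r (thirdPt q r) q
            + κL η (thirdPt ξ η) ξ (thirdPt q r) q r
            + κL η (thirdPt ξ η) ξ (thirdPt q r) r q)
          + (κL (thirdPt ξ η) ξ η q r (thirdPt q r)
            + κL (thirdPt ξ η) ξ η r q (thirdPt q r)
            + κL (thirdPt ξ η) ξ η q (thirdPt q r) r
            + κL (thirdPt ξ η) ξ η r (thirdPt q r) q
            + κL (thirdPt ξ η) ξ η (thirdPt q r) q r
            + κL (thirdPt ξ η) ξ η (thirdPt q r) r q)
          + (κL (thirdPt ξ η) η ξ q r (thirdPt q r)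
            + κL (thirdPt ξ η) η ξ r q (thirdPt q r)
            + κL (thirdPt ξ η) η ξ q (thirdPt q r) r
            + κL (thirdPt ξ η) η ξ r (thirdPt q r) q
            + κL (thirdPt ξ η) η ξ (thirdPt q r) q r
            + κL (thirdPt ξ η) η ξ (thirdPt q r) r q)))
      = (∑ ξ : Pd 1, ∑ η : Pd 1, ∑ q : Pd k, ∑ r : Pd k, (if TotDist ξ η = true then (1:ℤ) else 0) * (if TotDist q r = true then (1:ℤ) else 0) * ((κR ξ η (thirdPt ξ η) q r (thirdPt q r)
            + κR ξ η (thirdPt ξ η) r q (thirdPt q r)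
            + κR ξ η (thirdPt ξ η) q (thirdPt q r) r
            + κR ξ η (thirdPt ξ η) r (thirdPt q r) q
            + κR ξ η (thirdPt ξ η) (thirdPt q r) q r
            + κR ξ η (thirdPt ξ η) (thirdPt q r) r q)
          + (κR η ξ (thirdPt ξ η) q r (thirdPt q r)
            + κR η ξ (thirdPt ξ η) r q (thirdPt q r)
            + κR η ξ (thirdPt ξ η) q (thirdPt q r) r
            + κR η ξ (thirdPt ξ η) r (thirdPt q r) q
            + κR η ξ (thirdPt ξ η) (thirdPt q r) q r
            + κR η ξ (thirdPt ξ η) (thirdPt q r) r q)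
          + (κR ξ (thirdPt ξ η) η q r (thirdPt q r)
            + κR ξ (thirdPt ξ η) η r q (thirdPt q r)
            + κR ξ (thirdPt ξ η) η q (thirdPt q r) r
            + κR ξ (thirdPt ξ η) η r (thirdPt q r) q
            + κR ξ (thirdPt ξ η) η (thirdPt q r) q r
            + κR ξ (thirdPt ξ η) η (thirdPt q r) r q)
          + (κR η (thirdPt ξ η) ξ q r (thirdPt q r)
            + κR η (thirdPt ξ η) ξ r q (thirdPt q r)
            + κR η (thirdPt ξ η) ξ q (thirdPt q r) r
            + κR η (thirdPt ξ η) ξ r (thirdPt q r) q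
            + κR η (thirdPt ξ η) ξ (thirdPt q r) q r
            + κR η (thirdPt ξ η) ξ (thirdPt q r) r q)
          + (κR (thirdPt ξ η) ξ η q r (thirdPt q r)
            + κR (thirdPt ξ η) ξ η r q (thirdPt q r)
            + κR (thirdPt ξ η) ξ η q (thirdPt q r) r
            + κR (thirdPt ξ η) ξ η r (thirdPt q r) q
            + κR (thirdPt ξ η) ξ η (thirdPt q r) q r
            + κR (thirdPt ξ η) ξ η (thirdPt q r) r q)
          + (κR (thirdPt ξ η) η ξ q r (thirdPt q r)
            + κR (thirdPt ξ η) η ξ r q (thirdPt q r)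
            + κR (thirdPt ξ η) η ξ q (thirdPt q r) r
            + κR (thirdPt ξ η) η ξ r (thirdPt q r) q
            + κR (thirdPt ξ η) η ξ (thirdPt q r) q r
            + κR (thirdPt ξ η) η ξ (thirdPt q r) r q))) := by
    refine Finset.sum_congr rfl fun ξ _ => Finset.sum_congr rfl fun η _ => Finset.sum_congr rfl fun q _ => Finset.sum_congr rfl fun r _ => ?_
    by_cases hτ : TotDist ξ η = true
    · have hz := ind_orthant_latin_zero a ha0 hτ
      rw [← hXI] at hz
      simp only [hκL, hκR, hκ1, hκ2, hκ3, hκ4, hκ5, hκ6, hκ7, hκ8]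
      rcases hz with h | h | h <;> simp only [h] <;> ring
    · rw [if_neg hτ]; ring
  have key : 36 * (∑ ξ : Pd 1, ∑ η : Pd 1, ∑ q : Pd k, ∑ r : Pd k, (if TotDist ξ η = true then (1:ℤ) else 0) * (if TotDist q r = true then (1:ℤ) else 0) * (κL ξ η (thirdPt ξ η) q r (thirdPt q r)))
      = 36 * (∑ ξ : Pd 1, ∑ η : Pd 1, ∑ q : Pd k, ∑ r : Pd k, (if TotDist ξ η = true then (1:ℤ) else 0) * (if TotDist q r = true then (1:ℤ) else 0) * (κR ξ η (thirdPt ξ η) q r (thirdPt q r))) := by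
    have e1 : (36:ℤ) * (∑ ξ : Pd 1, ∑ η : Pd 1, ∑ q : Pd k, ∑ r : Pd k, (if TotDist ξ η = true then (1:ℤ) else 0) * (if TotDist q r = true then (1:ℤ) else 0) * (κL ξ η (thirdPt ξ η) q r (thirdPt q r))) = 6 * (6 * (∑ ξ : Pd 1, ∑ η : Pd 1, ∑ q : Pd k, ∑ r : Pd k, (if TotDist ξ η = true then (1:ℤ) else 0) * (if TotDist q r = true then (1:ℤ) else 0) * (κL ξ η (thirdPt ξ η) q r (thirdPt q r)))) := by ring
    have e2 : (36:ℤ) * (∑ ξ : Pd 1, ∑ η : Pd 1, ∑ q : Pd k, ∑ r : Pd k, (if TotDist ξ η = true then (1:ℤ) else 0) * (if TotDist q r = true then (1:ℤ) else 0) * (κR ξ η (thirdPt ξ η) q r (thirdPt q r))) = 6 * (6 * (∑ ξ : Pd 1, ∑ η : Pd 1, ∑ q : Pd k, ∑ r : Pd k, (if TotDist ξ η = true then (1:ℤ) else 0) * (if TotDist q r = true then (1:ℤ) else 0) * (κR ξ η (thirdPt ξ η) q r (thirdPt q r)))) := by ring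
    rw [e1, e2, ← hL6, ← hR6, ← hL36, ← hR36]
    exact hpt
  have hRnonneg : 0 ≤ (∑ ξ : Pd 1, ∑ η : Pd 1, ∑ q : Pd k, ∑ r : Pd k, (if TotDist ξ η = true then (1:ℤ) else 0) * (if TotDist q r = true then (1:ℤ) else 0) * (κR ξ η (thirdPt ξ η) q r (thirdPt q r))) := by
    simp only [hκR, mul_add, Finset.sum_add_distrib]
    have hsecA : ∀ ξ : Pd 1, IsUpperSet ((sect A ξ : Finset (Pd k)) : Set (Pd k)) := fun ξ => isUpperSet_sect hA ξ
    have hsecA' : ∀ ξ : Pd 1, IsUpperSet ((sect A' ξ : Finset (Pd k)) : Set (Pd k)) := fun ξ => isUpperSet_sect hA' ξ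
    have hfibA : ∀ q : Pd k, IsUpperSet ((fibre A q : Finset (Pd 1)) : Set (Pd 1)) := fun q => isUpperSet_fibre hA q
    have hfibA' : ∀ q : Pd k, IsUpperSet ((fibre A' q : Finset (Pd 1)) : Set (Pd 1)) := fun q => isUpperSet_fibre hA' q
    have hYJup : IsUpperSet (YJ : Set (Pd k)) := hYJ
    have i01 : ∀ (S : Finset (Pd 1)) (x : Pd 1), 0 ≤ ind S x ∧ ind S x ≤ 1 := fun S x => ⟨ind_nonneg' S x, ind_le_one' S x⟩
    have j01 : ∀ (S : Finset (Pd k)) (x : Pd k), 0 ≤ ind S x ∧ ind S x ≤ 1 := fun S x => ⟨ind_nonneg' S x, ind_le_one' S x⟩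
    -- family 1: Harris(A_ξ, A'_η ∩ Y)
    have f1 : 0 ≤ (∑ ξ : Pd 1, ∑ η : Pd 1, ∑ q : Pd k, ∑ r : Pd k, (if TotDist ξ η = true then (1:ℤ) else 0) * (if TotDist q r = true then (1:ℤ) else 0) * (κ1 ξ η (thirdPt ξ η) q r (thirdPt q r))) := by
      simp only [hκ1]
      refine ps_nonneg_of_innerJ (fun ξ η => ind XI ξ * (1 - ind XI η))
        (fun ξ η q r w => ind A (glue ξ q) * (ind A' (glue η q) * ind YJ q - ind A' (glue η r) * ind YJ r)) ?_ ?_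
      · intro ξ η; nlinarith [i01 XI ξ, i01 XI η]
      · intro ξ η _
        have h := pairKernel_harris_nonneg (sect A ξ) (sect A' η ∩ YJ) (hsecA ξ) (isUpperSet_inter_coe (hsecA' η) hYJup)
        simp only [ind_inter_eq_mul, ind_sect] at h
        exact h
    -- family 2: Harris(A'_ξ, A_η ∩ Y)
    have f2 : 0 ≤ (∑ ξ : Pd 1, ∑ η : Pd 1, ∑ q : Pd k, ∑ r : Pd k, (if TotDist ξ η = true then (1:ℤ) else 0) * (if TotDist q r = true then (1:ℤ) else 0) * (κ2 ξ η (thirdPt ξ η) q r (thirdPt q r))) := by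
      simp only [hκ2]
      refine ps_nonneg_of_innerJ (fun ξ η => ind XI ξ * (1 - ind XI η))
        (fun ξ η q r w => ind A' (glue ξ q) * (ind A (glue η q) * ind YJ q - ind A (glue η r) * ind YJ r)) ?_ ?_
      · intro ξ η; nlinarith [i01 XI ξ, i01 XI η]
      · intro ξ η _
        have h := pairKernel_harris_nonneg (sect A' ξ) (sect A η ∩ YJ) (hsecA' ξ) (isUpperSet_inter_coe (hsecA η) hYJup)
        simp only [ind_inter_eq_mul, ind_sect] at h
        exact h
    -- family 3: Kleitman(Ȳ; A_ξ, A'_ξ)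
    have f3 : 0 ≤ (∑ ξ : Pd 1, ∑ η : Pd 1, ∑ q : Pd k, ∑ r : Pd k, (if TotDist ξ η = true then (1:ℤ) else 0) * (if TotDist q r = true then (1:ℤ) else 0) * (κ3 ξ η (thirdPt ξ η) q r (thirdPt q r))) := by
      simp only [hκ3]
      refine ps_nonneg_of_innerJ (fun ξ η => ind XI ξ * (1 - ind XI η))
        (fun ξ η q r w => (1 - ind YJ q) * ind A (glue ξ r) * (ind A' (glue ξ r) - ind A' (glue ξ w))) ?_ ?_
      · intro ξ η; nlinarith [i01 XI ξ, i01 XI η]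
      · intro ξ η _
        have h := pairKernel_kleitman_nonneg (univ \ YJ) (sect A ξ) (sect A' ξ) (hsecA ξ) (hsecA' ξ)
        simp only [ind_sdiff_univ, ind_sect] at h
        exact h
    -- family 4: Harris(A_ξ, A'_ξ)
    have f4 : 0 ≤ (∑ ξ : Pd 1, ∑ η : Pd 1, ∑ q : Pd k, ∑ r : Pd k, (if TotDist ξ η = true then (1:ℤ) else 0) * (if TotDist q r = true then (1:ℤ) else 0) * (κ4 ξ η (thirdPt ξ η) q r (thirdPt q r))) := by
      simp only [hκ4]
      refine ps_nonneg_of_innerJ (fun ξ η => ind XI ξ * ind XI η)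
        (fun ξ η q r w => ind A (glue ξ q) * (ind A' (glue ξ q) - ind A' (glue ξ r))) ?_ ?_
      · intro ξ η; nlinarith [i01 XI ξ, i01 XI η]
      · intro ξ η _
        have h := pairKernel_harris_nonneg (sect A ξ) (sect A' ξ) (hsecA ξ) (hsecA' ξ)
        simp only [ind_sect] at h
        exact h
    -- family 5 (the Conjecture-P family) VANISHES: two totally distinct points of `[3]^1` are never both outside the literal `{1,2}`
    have f5 : 0 ≤ (∑ ξ : Pd 1, ∑ η : Pd 1, ∑ q : Pd k, ∑ r : Pd k, (if TotDist ξ η = true then (1:ℤ) else 0) * (if TotDist q r = true then (1:ℤ) else 0) * (κ5 ξ η (thirdPt ξ η) q r (thirdPt q r))) := by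
      simp only [hκ5]
      refine Finset.sum_nonneg fun ξ _ => Finset.sum_nonneg fun η _ => Finset.sum_nonneg fun q _ => Finset.sum_nonneg fun r _ => ?_
      by_cases hτ : TotDist ξ η = true
      · rcases ind_literal_pair_one a ha hτ with h | h
        · rw [h]; simp only [sub_self, zero_mul, mul_zero, le_refl]
        · rw [h]; simp only [sub_self, zero_mul, mul_zero, le_refl]
      · rw [if_neg hτ]; simp only [zero_mul, le_refl]
    -- family 6: fibre Kleitman around every middle point `η ≠ 0` (chart form of `Q_D` for the top cube)
    have f6 : 0 ≤ (∑ ξ : Pd 1, ∑ η : Pd 1, ∑ q : Pd k, ∑ r : Pd k, (if TotDist ξ η = true then (1:ℤ) else 0) * (if TotDist q r = true then (1:ℤ) else 0) * (κ6 ξ η (thirdPt ξ η) q r (thirdPt q r))) := by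
      simp only [hκ6]
      refine ps_nonneg_of_innerI (fun q r w => ind YJ q)
        (fun ξ η ζ q r => (1 - ind XI ξ * ind XI η) * (ind A' (glue ξ q) * (ind A (glue ξ q) - ind A (glue η q)))) ?_ ?_
      · intro q r; exact (j01 YJ q).1
      · intro q r _
        have h := pairKernel_fibreKleitman_weighted_nonneg (fun η : Pd 1 => 1 - (if η = 0 then (1:ℤ) else 0))
          (fun η => by split_ifs <;> norm_num) (fibre A q) (fibre A' q) (hfibA q) (hfibA' q)
        simp only [ind_fibre] at h
        rw [pairSum_rot (fun ξ η ζ => (1 - ind XI ξ * ind XI η) * (ind A' (glue ξ q) * (ind A (glue ξ q) - ind A (glue η q))))]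
        have e : (∑ ξ : Pd 1, ∑ η : Pd 1, (if TotDist ξ η = true then (1:ℤ) else 0) *
            ((1 - ind XI ξ * ind XI (thirdPt ξ η)) * (ind A' (glue ξ q) * (ind A (glue ξ q) - ind A (glue (thirdPt ξ η) q)))))
            = ∑ ξ : Pd 1, ∑ η : Pd 1, (if TotDist ξ η = true then (1:ℤ) else 0) *
              ((1 - (if η = 0 then (1:ℤ) else 0)) * (ind A' (glue ξ q) * (ind A (glue ξ q) - ind A (glue (thirdPt ξ η) q)))) := by
          refine Finset.sum_congr rfl fun ξ _ => Finset.sum_congr rfl fun η _ => ?_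
          by_cases hτ : TotDist ξ η = true
          · have hz := ind_ones_mul_third a ha hτ
            rw [← hXI] at hz
            rw [hz]
          · rw [if_neg hτ]; ring
        rw [e]; exact h
    -- family 7 (the `Q_E` family) VANISHES: a point of the literal has no completion to a Latin triple by two outside points
    have f7 : 0 ≤ (∑ ξ : Pd 1, ∑ η : Pd 1, ∑ q : Pd k, ∑ r : Pd k, (if TotDist ξ η = true then (1:ℤ) else 0) * (if TotDist q r = true then (1:ℤ) else 0) * (κ7 ξ η (thirdPt ξ η) q r (thirdPt q r))) := by
      simp only [hκ7]
      refine Finset.sum_nonneg fun ξ _ => Finset.sum_nonneg fun η _ => Finset.sum_nonneg fun q _ => Finset.sum_nonneg fun r _ => ?_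
      by_cases hτ : TotDist ξ η = true
      · rcases ind_literal_third_one a ha hτ with h | h
        · rw [h]; simp only [sub_self, zero_mul, mul_zero, le_refl]
        · rw [h]; simp only [sub_self, zero_mul, mul_zero, le_refl]
      · rw [if_neg hτ]; simp only [zero_mul, le_refl]
    -- family 8: fibre Kleitman around `0` (chart form of `Q_X` for the top cube)
    have f8 : 0 ≤ (∑ ξ : Pd 1, ∑ η : Pd 1, ∑ q : Pd k, ∑ r : Pd k, (if TotDist ξ η = true then (1:ℤ) else 0) * (if TotDist q r = true then (1:ℤ) else 0) * (κ8 ξ η (thirdPt ξ η) q r (thirdPt q r))) := by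
      simp only [hκ8]
      refine ps_nonneg_of_innerI (fun q r w => 2 - ind YJ w)
        (fun ξ η ζ q r => (ind XI ξ * ind XI η) * ((ind A (glue ξ q) - ind A (glue η q)) * ind A' (glue ξ r))) ?_ ?_
      · intro q r; nlinarith [j01 YJ (thirdPt q r)]
      · intro q r _
        have h := pairKernel_fibreKleitman_weighted_nonneg (fun η : Pd 1 => if η = 0 then (1:ℤ) else 0)
          (fun η => by split_ifs <;> norm_num) (fibre A q) (fibre A' r) (hfibA q) (hfibA' r)
        simp only [ind_fibre] at h
        rw [pairSum_rot (fun ξ η ζ => (ind XI ξ * ind XI η) * ((ind A (glue ξ q) - ind A (glue η q)) * ind A' (glue ξ r)))]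
        have e : (∑ ξ : Pd 1, ∑ η : Pd 1, (if TotDist ξ η = true then (1:ℤ) else 0) *
            ((ind XI ξ * ind XI (thirdPt ξ η)) * ((ind A (glue ξ q) - ind A (glue (thirdPt ξ η) q)) * ind A' (glue ξ r))))
            = ∑ ξ : Pd 1, ∑ η : Pd 1, (if TotDist ξ η = true then (1:ℤ) else 0) *
              ((if η = 0 then (1:ℤ) else 0) * (ind A' (glue ξ r) * (ind A (glue ξ q) - ind A (glue (thirdPt ξ η) q)))) := by
          refine Finset.sum_congr rfl fun ξ _ => Finset.sum_congr rfl fun η _ => ?_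
          by_cases hτ : TotDist ξ η = true
          · have hz := ind_ones_mul_third a ha hτ
            rw [← hXI] at hz
            rw [hz]; ring
          · rw [if_neg hτ]; ring
        rw [e]; exact h
    linarith [f1, f2, f3, f4, f5, f6, f7, f8]
  linarith [key, hRnonneg]

/-- **LITERAL ABSORPTION, every dimension**: for every `k`, every up-set `Y_J ⊆ [3]^k`, every `m` and all up-sets `B, C`:
`0 ≤ sStarD (({x₀ ≥ 1} ∪ [3] × Y_J) × [3]^m) B C` — a threshold-one literal OR-ed to ANY block pattern is a good slot in every dimension.
[this work] -/
theorem sStarD_cylSet_literalUnion_nonneg {m : ℕ} (YJ : Finset (Pd k)) (hYJ : IsUpperSet (YJ : Set (Pd k)))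
    {B C : Finset (Pd (m + (1 + k)))} (hB : IsUpperSet (B : Set (Pd (m + (1 + k))))) (hC : IsUpperSet (C : Set (Pd (m + (1 + k))))) :
    0 ≤ sStarD (cylSet ((univ.filter fun x : Pd (1 + k) => 1 ≤ x (Fin.castAdd k 0))
        ∪ (univ.filter fun x : Pd (1 + k) => (fun j => x (Fin.natAdd 1 j)) ∈ YJ)) : Finset (Pd (m + (1 + k)))) B C := by
  set a : Pd 1 := fun _ => 1 with ha_def
  have ha : ∀ i, a i = 1 := fun _ => rfl
  have hX : ∀ (ξ : Pd 1) (q : Pd k), glue ξ q ∈ (univ.filter fun x : Pd (1 + k) => 1 ≤ x (Fin.castAdd k 0))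
      ↔ ξ ∈ (univ.filter fun x : Pd 1 => ∀ i, a i ≤ x i) := by
    intro ξ q
    simp only [Finset.mem_filter, Finset.mem_univ, true_and, glue_castAdd]
    constructor
    · intro h i; rw [ha i, Subsingleton.elim i 0]; exact h
    · intro h; have h0 := h 0; rw [ha 0] at h0; exact h0
  have hY : ∀ (ξ : Pd 1) (q : Pd k), glue ξ q ∈ (univ.filter fun x : Pd (1 + k) => (fun j => x (Fin.natAdd 1 j)) ∈ YJ)
      ↔ q ∈ YJ := by
    intro ξ q
    simp only [Finset.mem_filter, Finset.mem_univ, true_and, glue_natAdd]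
  exact sStarD_cylSet_pairCert_nonneg_of_sStarD_ge hX hY (isUpperSet_filter_le a) hYJ (literalUnion_hS a ha YJ hYJ hX hY) hB hC

end Summit.CriticalPhenomena.PercolationContinuityZ3.Theorems.SahiGridPattern
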